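import Literature.NumberTheory.Automorphic.QuaternionTorusCentralizer
import Literature.NumberTheory.Automorphic.AdelicGroupDataQuotientClosed
import HarnessLib

/-!
# Functoriality of the adelic unit datum in isomorphisms of algebras: `D' ≅ D ⇒ D'_𝔸ˣ ≅ D_𝔸ˣ`,
`ℝ_{>0} D'ˣ ↦ ℝ_{>0} Dˣ`, equal covolumes
(Gelbart, *Automorphic forms on adele groups* (1975), p. 155: `meas(Z'_𝔸 B'_F \ B'_𝔸) = meas(Z_𝔸 B_F \ B_𝔸)`
for the isomorphic tori `B' = B'(E) ≤ D^×`, `B = B(E) ≤ GL(2)` of one quadratic extension `E`;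
Jacquet–Langlands, LNM 114, §16)

Topic `NumberTheory/Automorphic`. Definitions (`adelicUnitsCongr`, `AdelicGroupData.unitsCongr`)
and theorems; no named fact, no instance.

Universes: in the `Units` and `Volume` sections `D : Type u` and `D' : Type v` may live in different
universes (v2 of this file; v1 had both in `Type u`): the consumer compares the torus
`T = K(γ') ≤ D : Type u` of `Dˣ` with the torus `E = K(γ) ≤ M₂(K) : Type` of `GL(2)`. Nothing else changed.

For finite-dimensional `K`-algebras `D'`, `D` over a number field `K` and a `K`-algebra
isomorphism `e : D' ≃ₐ[K] D`:

* `adelicUnitsCongr K e : (𝔸_K ⊗_K D')ˣ ≃ₜ* (𝔸_K ⊗_K D)ˣ` — `unitsMapRight e` with inverse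
  `unitsMapRight e⁻¹` (`QuaternionAdelicTorus`), an isomorphism of topological groups; keyed on the
  data as `AdelicGroupData.unitsCongr K e : (units K D').Adelic ≃ₜ* (units K D).Adelic`;
* `unitsCongr_toAdelic`, `unitsCongr_posRealCentral` — it carries the rational points `D'ˣ` onto
  `Dˣ` (through `e`) and fixes the split centre `ℝ_{>0}`, hence
  **`unitsCongr_mem_quotientSubgroup_iff` / `map_quotientSubgroup_unitsCongr`: `ℝ_{>0} D'ˣ ↦ ℝ_{>0} Dˣ`**;
* `units_quotientMeasure_univ_eq_of_algEquiv` — **for Haar-type measures corresponding under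
  `unitsCongr e`, `vol(D'_𝔸ˣ ⧸ ℝ_{>0} D'ˣ) = vol(D_𝔸ˣ ⧸ ℝ_{>0} Dˣ)`** (total masses of the quotient
  measures with Weil constant one; `quotientMeasure_univ_eq_of_mulEquiv`,
  `InvariantQuotientTransport`), with the non-vacuity statement `units_exists_congr_measures`
  and the instance binders discharged by `units_congr_volume_hypotheses`.

Applied to the quadratic algebras `T = K(γ') ≤ D` and `E = K(γ) ≤ M₂(K)` of matching regular /
elliptic classes (`T ≅ E` when `(trd, nrd)(γ') = (tr, det)(γ)`), this is the equality of the volume factors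
of the elliptic terms of the two trace formulas (10.14), (10.15) — Gelbart (1975), p. 155 — which
on each side are the covolumes of `ℝ_{>0} Tˣ ≤ T_𝔸ˣ`, `ℝ_{>0} Eˣ ≤ E_𝔸ˣ`
(`units_quotientMeasure_centralizer_univ_eq_torus`, `glTwo_quotientMeasure_centralizer_univ_eq_torus`).
A brick of the inline (D-0026) decomposition of
`Literature.NumberTheory.Automorphic.strong_multiplicity_one_quaternionUnits` (Gelbart Thm. 10.5).

## References

* S. Gelbart, *Automorphic forms on adele groups*, Ann. of Math. Studies 83 (1975), p. 155
  [Gelbart1975].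
* H. Jacquet, R. P. Langlands, *Automorphic forms on GL(2)*, LNM 114 (1970), §16
  [JacquetLanglands1970].
-/

noncomputable section

open scoped TensorProduct NNReal ENNReal
open NumberField IsDedekindDomain MeasureTheory Measure Topology
open Literature.MeasureTheory.Group

namespace Literature.NumberTheory.Automorphic

universe u v

/-! ### `mapRight` of an isomorphism -/

section MapRight

variable (K : Type*) [Field K] (R : Type*) [CommRing R] [Algebra K R]
  {D : Type*} [Ring D] [Algebra K D] {D' : Type*} [Ring D'] [Algebra K D']

/-- `mapRight e⁻¹ ∘ mapRight e = id` for a `K`-algebra isomorphism `e`. [folklore] -/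
theorem ScalarExtension.mapRight_symm_apply_apply (e : D' ≃ₐ[K] D) (z : ScalarExtension K R D') :
    ScalarExtension.mapRight K R (e.symm : D →ₐ[K] D') (ScalarExtension.mapRight K R (e : D' →ₐ[K] D) z) = z := by
  change ScalarExtension.mapRight K R (e.symm : D →ₐ[K] D')
    (ScalarExtension.mapRight K R (e : D' →ₐ[K] D) (ScalarExtension.ofTensor K R D' (show R ⊗[K] D' from z))) =
    ScalarExtension.ofTensor K R D' (show R ⊗[K] D' from z)
  generalize (show R ⊗[K] D' from z) = z'
  induction z' using TensorProduct.induction_on with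
  | zero => simp only [map_zero]
  | tmul r x =>
    rw [ScalarExtension.mapRight_tmul, ScalarExtension.mapRight_tmul]
    simp only [AlgEquiv.coe_toAlgHom, AlgEquiv.symm_apply_apply]
  | add a b ha hb => rw [map_add, map_add, map_add, ha, hb]

/-- `mapRight e ∘ mapRight e⁻¹ = id` for a `K`-algebra isomorphism `e`. [folklore] -/
theorem ScalarExtension.mapRight_apply_symm_apply (e : D' ≃ₐ[K] D) (z : ScalarExtension K R D) :
    ScalarExtension.mapRight K R (e : D' →ₐ[K] D) (ScalarExtension.mapRight K R (e.symm : D →ₐ[K] D') z) = z :=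
  ScalarExtension.mapRight_symm_apply_apply K R e.symm z

end MapRight

/-! ### The isomorphism of adelic unit groups -/

section Units

variable (K : Type) [Field K] [NumberField K] {D : Type u} [Ring D] [Algebra K D]
  {D' : Type v} [Ring D'] [Algebra K D'] [Module.Finite K D] [Module.Finite K D']

/-- **`D' ≅ D ⇒ D'_𝔸ˣ ≅ D_𝔸ˣ` as topological groups**: the isomorphism
`(𝔸_K ⊗_K D')ˣ ≃ₜ* (𝔸_K ⊗_K D)ˣ` induced by a `K`-algebra isomorphism `e : D' ≃ D`
(`unitsMapRight e`, inverse `unitsMapRight e⁻¹`, both continuous). [folklore] -/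
def adelicUnitsCongr (e : D' ≃ₐ[K] D) : adelicUnits K D' ≃ₜ* adelicUnits K D :=
  { toFun := unitsMapRight K D (e : D' →ₐ[K] D)
    invFun := unitsMapRight K D' (e.symm : D →ₐ[K] D')
    left_inv := fun _ => Units.ext (ScalarExtension.mapRight_symm_apply_apply K _ e _)
    right_inv := fun _ => Units.ext (ScalarExtension.mapRight_apply_symm_apply K _ e _)
    map_mul' := fun x y => map_mul _ x y
    continuous_toFun := continuous_unitsMapRight K D _
    continuous_invFun := continuous_unitsMapRight K D' _ }

/-- `adelicUnitsCongr e = unitsMapRight e` as a function (definitional). [folklore] -/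
@[simp]
theorem adelicUnitsCongr_apply (e : D' ≃ₐ[K] D) (u : adelicUnits K D') :
    adelicUnitsCongr K e u = unitsMapRight K D (e : D' →ₐ[K] D) u := rfl

/-- `(adelicUnitsCongr e)⁻¹ = unitsMapRight e⁻¹` as a function (definitional). [folklore] -/
@[simp]
theorem adelicUnitsCongr_symm_apply (e : D' ≃ₐ[K] D) (u : adelicUnits K D) :
    (adelicUnitsCongr K e).symm u = unitsMapRight K D' (e.symm : D →ₐ[K] D') u := rfl

/-- **The isomorphism keyed on the adelic group data**: `(units K D').Adelic ≃ₜ* (units K D).Adelic`.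
[folklore] -/
def AdelicGroupData.unitsCongr (e : D' ≃ₐ[K] D) :
    (AdelicGroupData.units K D').Adelic ≃ₜ* (AdelicGroupData.units K D).Adelic :=
  adelicUnitsCongr K e

/-- `unitsCongr e = unitsMapRight e` as a function (definitional). [folklore] -/
theorem AdelicGroupData.unitsCongr_apply (e : D' ≃ₐ[K] D) (u : (AdelicGroupData.units K D').Adelic) :
    AdelicGroupData.unitsCongr K e u = unitsMapRight K D (e : D' →ₐ[K] D) u := rfl

/-- **Compatibility with the rational points**: `unitsCongr e (1 ⊗ x) = 1 ⊗ e x`. [folklore] -/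
theorem AdelicGroupData.unitsCongr_toAdelic (e : D' ≃ₐ[K] D) (x : (AdelicGroupData.units K D').Rational) :
    AdelicGroupData.unitsCongr K e ((AdelicGroupData.units K D').toAdelic x) =
      (AdelicGroupData.units K D).toAdelic (Units.map (e : D' →ₐ[K] D).toRingHom.toMonoidHom x) :=
  unitsMapRight_inclAdelic K D _ x

/-- **Compatibility with the split centre**: `unitsCongr e` fixes `ℝ_{>0}`. [folklore] -/
theorem AdelicGroupData.unitsCongr_posRealCentral (e : D' ≃ₐ[K] D) (t : ℝ≥0ˣ) :
    AdelicGroupData.unitsCongr K e (posRealCentral K D' t) = posRealCentral K D t :=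
  unitsMapRight_posRealCentral K D _ t

/-- **`unitsCongr e u ∈ ℝ_{>0} Dˣ ↔ u ∈ ℝ_{>0} D'ˣ`** (`unitsMapRight` of `e` and of `e⁻¹` map the
subgroups into each other, `map_quotientSubgroup_units_le`). [folklore] -/
theorem AdelicGroupData.unitsCongr_mem_quotientSubgroup_iff (e : D' ≃ₐ[K] D)
    (u : (AdelicGroupData.units K D').Adelic) :
    AdelicGroupData.unitsCongr K e u ∈ (AdelicGroupData.units K D).quotientSubgroup ↔
      u ∈ (AdelicGroupData.units K D').quotientSubgroup := by
  constructor
  · intro hu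
    have h := map_quotientSubgroup_units_le K D' (e.symm : D →ₐ[K] D') ⟨_, hu, rfl⟩
    have h2 : unitsMapRight K D' (e.symm : D →ₐ[K] D') (AdelicGroupData.unitsCongr K e u) = u :=
      (adelicUnitsCongr K e).symm_apply_apply u
    rwa [h2] at h
  · intro hu
    exact map_quotientSubgroup_units_le K D (e : D' →ₐ[K] D) ⟨u, hu, rfl⟩

/-- **`unitsCongr e` carries `ℝ_{>0} D'ˣ` onto `ℝ_{>0} Dˣ`.** [folklore] -/
theorem AdelicGroupData.map_quotientSubgroup_unitsCongr (e : D' ≃ₐ[K] D) :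
    (AdelicGroupData.units K D').quotientSubgroup.map (AdelicGroupData.unitsCongr K e).toMonoidHom =
      (AdelicGroupData.units K D).quotientSubgroup := by
  ext g
  constructor
  · intro hg
    obtain ⟨u, hu, rfl⟩ := Subgroup.mem_map.1 hg
    exact (AdelicGroupData.unitsCongr_mem_quotientSubgroup_iff K e u).2 hu
  · intro hg
    refine Subgroup.mem_map.2 ⟨(AdelicGroupData.unitsCongr K e).symm g, ?_, ?_⟩
    · rw [← AdelicGroupData.unitsCongr_mem_quotientSubgroup_iff K e]
      rwa [(AdelicGroupData.unitsCongr K e).apply_symm_apply]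
    · exact (AdelicGroupData.unitsCongr K e).apply_symm_apply g

end Units

/-! ### Equal covolumes -/

section Volume

variable (K : Type) [Field K] [NumberField K] {D : Type u} [Ring D] [Algebra K D]
  {D' : Type v} [Ring D'] [Algebra K D'] [Module.Finite K D] [Module.Finite K D']

attribute [local instance] AdelicGroupData.measurableSpaceQuotientForm
  AdelicGroupData.borelSpaceQuotientForm

/-- **Isomorphic algebras have equal adelic covolumes**: for a `K`-algebra isomorphism
`e : D' ≃ D` and Haar-type measures corresponding under `unitsCongr e` — `ν = e_* ν'` on `D_𝔸ˣ`,
`ρ = (e|)_* ρ'` on `ℝ_{>0} Dˣ` — the total masses of the quotient measures agree: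
`vol(D_𝔸ˣ ⧸ ℝ_{>0} Dˣ; ν, ρ) = vol(D'_𝔸ˣ ⧸ ℝ_{>0} D'ˣ; ν', ρ')` (Weil constant one on both sides;
`quotientMeasure_univ_eq_of_mulEquiv`). For the quadratic algebras `K(γ') ≅ K(γ)` of matching
classes this is `meas(Z'_𝔸 B'_F \ B'_𝔸) = meas(Z_𝔸 B_F \ B_𝔸)` (Gelbart (1975), p. 155). The instance
binders hold by `units_congr_volume_hypotheses`. [cite: Gelbart1975, p. 155] -/
theorem units_quotientMeasure_univ_eq_of_algEquiv (e : D' ≃ₐ[K] D)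
    [MeasurableSpace (AdelicGroupData.units K D).Adelic] [BorelSpace (AdelicGroupData.units K D).Adelic]
    [MeasurableSpace (AdelicGroupData.units K D').Adelic] [BorelSpace (AdelicGroupData.units K D').Adelic]
    [LocallyCompactSpace (AdelicGroupData.units K D).Adelic]
    [SecondCountableTopology (AdelicGroupData.units K D).Adelic] [T2Space (AdelicGroupData.units K D).Adelic]
    [LocallyCompactSpace (AdelicGroupData.units K D').Adelic]
    [SecondCountableTopology (AdelicGroupData.units K D').Adelic] [T2Space (AdelicGroupData.units K D').Adelic]
    [hH : IsClosed ((AdelicGroupData.units K D).quotientSubgroup : Set (AdelicGroupData.units K D).Adelic)]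
    [hH' : IsClosed ((AdelicGroupData.units K D').quotientSubgroup : Set (AdelicGroupData.units K D').Adelic)]
    (ν : Measure (AdelicGroupData.units K D).Adelic) [IsHaarMeasure ν] [ν.IsMulRightInvariant]
    (ρ : Measure ↥((AdelicGroupData.units K D).quotientSubgroup))
    [ρ.IsMulLeftInvariant] [IsFiniteMeasureOnCompacts ρ] [ρ.IsOpenPosMeasure] [ρ.IsInvInvariant] [SFinite ρ]
    (ν' : Measure (AdelicGroupData.units K D').Adelic) [IsHaarMeasure ν'] [ν'.IsMulRightInvariant]
    (ρ' : Measure ↥((AdelicGroupData.units K D').quotientSubgroup))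
    [ρ'.IsMulLeftInvariant] [IsFiniteMeasureOnCompacts ρ'] [ρ'.IsOpenPosMeasure] [ρ'.IsInvInvariant]
    [SFinite ρ']
    (hν : ν = Measure.map (AdelicGroupData.unitsCongr K e) ν')
    (hρ : ρ = Measure.map (subgroupCongrHomeomorph (AdelicGroupData.unitsCongr K e).toMulEquiv
      ((AdelicGroupData.units K D').quotientSubgroup) ((AdelicGroupData.units K D).quotientSubgroup)
      (AdelicGroupData.unitsCongr_mem_quotientSubgroup_iff K e) (AdelicGroupData.unitsCongr K e).continuous
      (AdelicGroupData.unitsCongr K e).symm.continuous) ρ') :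
    quotientMeasure ((AdelicGroupData.units K D).quotientSubgroup) ρ hH ν Set.univ =
      quotientMeasure ((AdelicGroupData.units K D').quotientSubgroup) ρ' hH' ν' Set.univ :=
  quotientMeasure_univ_eq_of_mulEquiv (AdelicGroupData.unitsCongr K e).toMulEquiv
    (AdelicGroupData.unitsCongr K e).continuous (AdelicGroupData.unitsCongr K e).symm.continuous _ _
    (AdelicGroupData.unitsCongr_mem_quotientSubgroup_iff K e) ρ' ρ ν' ν hρ hν

/-- **The corresponding measures exist** (non-vacuity of `units_quotientMeasure_univ_eq_of_algEquiv`):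
the pull-backs of `ν`, `ρ` along `unitsCongr e` are Haar-type measures on `D'_𝔸ˣ`, `ℝ_{>0} D'ˣ` whose
images are `ν`, `ρ`. [folklore] -/
theorem units_exists_congr_measures (e : D' ≃ₐ[K] D)
    [MeasurableSpace (AdelicGroupData.units K D).Adelic] [BorelSpace (AdelicGroupData.units K D).Adelic]
    [MeasurableSpace (AdelicGroupData.units K D').Adelic] [BorelSpace (AdelicGroupData.units K D').Adelic]
    (ν : Measure (AdelicGroupData.units K D).Adelic) [IsHaarMeasure ν] [ν.IsMulRightInvariant]
    (ρ : Measure ↥((AdelicGroupData.units K D).quotientSubgroup))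
    [IsHaarMeasure ρ] [ρ.IsInvInvariant] [SFinite ρ] :
    ∃ (ν' : Measure (AdelicGroupData.units K D').Adelic)
      (ρ' : Measure ↥((AdelicGroupData.units K D').quotientSubgroup)),
      IsHaarMeasure ν' ∧ ν'.IsMulRightInvariant ∧ IsHaarMeasure ρ' ∧ ρ'.IsInvInvariant ∧ SFinite ρ' ∧
      ν = Measure.map (AdelicGroupData.unitsCongr K e) ν' ∧
      ρ = Measure.map (subgroupCongrHomeomorph (AdelicGroupData.unitsCongr K e).toMulEquiv
        ((AdelicGroupData.units K D').quotientSubgroup) ((AdelicGroupData.units K D).quotientSubgroup)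
        (AdelicGroupData.unitsCongr_mem_quotientSubgroup_iff K e) (AdelicGroupData.unitsCongr K e).continuous
        (AdelicGroupData.unitsCongr K e).symm.continuous) ρ' := by
  set f := AdelicGroupData.unitsCongr K e with hf
  set fH := subgroupCongrHomeomorph f.toMulEquiv
    ((AdelicGroupData.units K D').quotientSubgroup) ((AdelicGroupData.units K D).quotientSubgroup)
    (AdelicGroupData.unitsCongr_mem_quotientSubgroup_iff K e) f.continuous f.symm.continuous with hfH
  -- the multiplicative structure of `fH`
  set fHm : ↥((AdelicGroupData.units K D').quotientSubgroup) ≃* ↥((AdelicGroupData.units K D).quotientSubgroup) :=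
    { fH.toEquiv with
      map_mul' := fun x y => Subtype.ext (map_mul f.toMulEquiv (x : (AdelicGroupData.units K D').Adelic) y) }
    with hfHm
  refine ⟨Measure.map f.symm ν, Measure.map fHm.symm ρ, inferInstance,
    isMulRightInvariant_map_mulEquiv f.symm.toMulEquiv f.symm.continuous.measurable
      f.continuous.measurable ν,
    MulEquiv.isHaarMeasure_map ρ fHm.symm fH.symm.continuous fH.continuous,
    isInvInvariant_map_mulEquiv fHm.symm fH.symm.continuous.measurable ρ, inferInstance, ?_, ?_⟩
  · exact (f.toHomeomorph.toMeasurableEquiv.map_map_symm (ν := ν)).symm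
  · exact (fH.toMeasurableEquiv.map_map_symm (ν := ρ)).symm

/-- **The hypotheses of `units_quotientMeasure_univ_eq_of_algEquiv` hold** for non-trivial
finite-dimensional `D`, `D'`: local compactness, the Hausdorff property and second countability of
`D_𝔸ˣ`, `D'_𝔸ˣ` (`units_adelic_topology`) and closedness of `ℝ_{>0} Dˣ`, `ℝ_{>0} D'ˣ`
(`isClosed_quotientSubgroup_units`). [folklore] -/
theorem units_congr_volume_hypotheses [Nontrivial D] [Nontrivial D'] :
    LocallyCompactSpace (AdelicGroupData.units K D).Adelic ∧ T2Space (AdelicGroupData.units K D).Adelic ∧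
      SecondCountableTopology (AdelicGroupData.units K D).Adelic ∧
      IsClosed ((AdelicGroupData.units K D).quotientSubgroup : Set (AdelicGroupData.units K D).Adelic) ∧
      LocallyCompactSpace (AdelicGroupData.units K D').Adelic ∧ T2Space (AdelicGroupData.units K D').Adelic ∧
      SecondCountableTopology (AdelicGroupData.units K D').Adelic ∧
      IsClosed ((AdelicGroupData.units K D').quotientSubgroup : Set (AdelicGroupData.units K D').Adelic) := by
  obtain ⟨i₁, i₂, i₃⟩ := units_adelic_topology K D
  obtain ⟨j₁, j₂, j₃⟩ := units_adelic_topology K D'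
  exact ⟨i₁, i₂, i₃, AdelicGroupData.isClosed_quotientSubgroup_units K D, j₁, j₂, j₃,
    AdelicGroupData.isClosed_quotientSubgroup_units K D'⟩

end Volume

end Literature.NumberTheory.Automorphic
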